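import Mathlib
import Summits.MatrixMultiplication.MatrixMultiplication.Theses.AutomaticSTPPDesigns
import Summits.MatrixMultiplication.MatrixMultiplication.Theorems.AutomaticSTPPDesignsRegularTowerGap
import Summits.MatrixMultiplication.MatrixMultiplication.Theorems.AutomaticSTPPDesignsAutomaticPackingThesisNormalForm

/-!
# Forward rung over `RegularTowerGap` (seed g1-MatrixMultiplication-7358) — the Chomsky ladder of tower gaps

FLOOR (proved, `Summit.MatrixMultiplication.MatrixMultiplication.Theorems.RegularTowerGap.regularTowerGap_proof`):
`RegularTowerGap` — every triple of REGULAR languages over `ι × Fin p` whose automatic block family is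
STPP in `ℤ/(p^k)` at every scale has a uniform exponent gap `ε > 0` at all large scales.

GRADED FAMILY. `TowerGap 𝒞` := the same statement with "regular" replaced by an arbitrary class of
languages `𝒞 : ∀ α, Language α → Prop`. It is ANTITONE in `𝒞`:
* `TowerGap (fun _ L => L.IsRegular)` is the floor (definitionally: `towerGap_regular`);
* `ContextFreeTowerGap := TowerGap (fun _ L => L.IsContextFree)` is the NEXT RUNG (one move:
  the hypothesis "regular" generalised to "context-free"; Mathlib `Language.IsContextFree`);
* `AllTowerGap := TowerGap (fun _ _ => True)` is the TOP of the ladder, and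
  `allTowerGap_iff_not_automaticPackingThesis` identifies it with the NEGATION of the parent route's
  open crux `AutomaticPackingThesis` (→: interleave the beating levels of the witnessing regular
  towers into ONE unrestricted tower over the alphabet `Fin p`, after compressing each level's index
  set into the digit words by the packing bound; ←: the refutation normal form = a uniform cyclic
  packing ceiling).

OFF-PATH CERTIFICATES (why no route / line is filed from this floor):
* `towerGap_of_not_summit : ¬ MatrixMultiplication → TowerGap 𝒞` — every rung of the ladder is a
  consequence of `ω(ℂ) > 2` (CKSU 2005 Thm 5.5 at `ε = ω - 2`), i.e. the ladder climbs toward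
  `¬ AutomaticPackingThesis` (the parent route's kill criterion), not toward `ω = 2`;
* `towerGap_of_not_automaticPackingThesis : ¬ AutomaticPackingThesis → TowerGap 𝒞`.
-/

set_option linter.dupNamespace false

noncomputable section

open Finset

open scoped BigOperators Classical

namespace Summit.MatrixMultiplication.MatrixMultiplication.Cruxes.AutomaticPackingThesis.FwdRung

open Literature.Combinatorics.Additive (AddSimultaneousTPP addSimultaneousTPP_iff_forall)
open Literature.Computability.AlgebraicComplexity
open Literature.Computability.AutomaticStructures
open Summit.MatrixMultiplication.MatrixMultiplication.Theses.AutomaticSTPPDesigns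

/-- **The graded family.** `TowerGap 𝒞`: for every base `p ≥ 2`, every finite index alphabet `ι` and
every triple of languages `LA LB LC` over `ι × Fin p` lying in the class `𝒞`, if the block family
`(A_w, B_w, C_w)_{w ∈ ι^k}` read at scale `k` (verbatim the parent route's inlined `blk`) is STPP in
`ℤ/(p^k)` at every scale, then some `ε > 0` has `∑_w (|A_w||B_w||C_w|)^{(2+ε)/3} ≤ p^k` at all large
scales. The floor `RegularTowerGap` is `TowerGap (fun _ L => L.IsRegular)` on the nose. -/
def TowerGap (𝒞 : ∀ α : Type, Language α → Prop) : Prop :=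
  ∀ (p : ℕ) (ι : Type) [Fintype ι] (LA LB LC : Language (ι × Fin p)), 2 ≤ p →
    𝒞 _ LA → 𝒞 _ LB → 𝒞 _ LC →
    let blk := fun (k : ℕ) (L : Language (ι × Fin p)) (w : Fin k → ι) =>
      ((Finset.univ : Finset (Fin k → Fin p)).filter
        (fun a => List.ofFn (fun j : Fin k => (w j, a j)) ∈ L)).image
        (fun a : Fin k → Fin p => ((∑ j : Fin k, (a j : ℕ) * p ^ (j : ℕ) : ℕ) : ZMod (p ^ k)));
    (∀ k : ℕ, Literature.Combinatorics.Additive.AddSimultaneousTPP (blk k LA) (blk k LB) (blk k LC)) →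
      ∃ ε : ℝ, 0 < ε ∧ ∃ k₀ : ℕ, ∀ k ≥ k₀,
        ∑ w : Fin k → ι, (((blk k LA w).card * (blk k LB w).card * (blk k LC w).card : ℕ) : ℝ) ^
          ((2 + ε) / 3) ≤ (p : ℝ) ^ k

/-- Rung 0 = the FLOOR: regular languages (finite automata). -/
def RegularRung : Prop := TowerGap (fun _ L => L.IsRegular)

/-- **Rung 1 = the NEXT RUNG** (one move: "regular" ↦ "context-free", i.e. finite automata ↦
pushdown automata / algebraic power series in place of rational ones). -/
def ContextFreeTowerGap : Prop := TowerGap (fun _ L => L.IsContextFree)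

/-- The TOP of the ladder: no restriction on the three languages (an arbitrary "tower" of block
families, one STPP family in `ℤ/(p^k)` per scale, indexed by words over a fixed finite alphabet). -/
def AllTowerGap : Prop := TowerGap (fun _ _ => True)

/-- The floor is literally the `IsRegular` member of the family (definitional unfolding). -/
theorem regularRung_iff : RegularRung ↔ RegularTowerGap := Iff.rfl

/-- F3 witness, by name: the seed theorem proves rung 0. -/
theorem towerGap_regular : TowerGap (fun _ L => L.IsRegular) :=
  Summit.MatrixMultiplication.MatrixMultiplication.Theorems.RegularTowerGap.regularTowerGap_proof

/-- The family is antitone in the class: a gap for a larger class of languages is a gap for every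
smaller class. -/
theorem towerGap_anti {𝒞 𝒟 : ∀ α : Type, Language α → Prop} (h𝒞𝒟 : ∀ α L, 𝒞 α L → 𝒟 α L)
    (h : TowerGap 𝒟) : TowerGap 𝒞 :=
  fun p ι _ LA LB LC hp hA hB hC =>
    h p ι LA LB LC hp (h𝒞𝒟 _ _ hA) (h𝒞𝒟 _ _ hB) (h𝒞𝒟 _ _ hC)

/-- The top implies every rung. -/
theorem towerGap_of_allTowerGap (𝒞 : ∀ α : Type, Language α → Prop) (h : AllTowerGap) :
    TowerGap 𝒞 :=
  towerGap_anti (fun _ _ _ => trivial) h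

/-- In particular the top implies the next rung … -/
theorem contextFreeTowerGap_of_allTowerGap (h : AllTowerGap) : ContextFreeTowerGap :=
  towerGap_of_allTowerGap _ h

/-- **Off-path certificate 1.** If the parent crux FAILS, every rung holds: the refutation normal
form `not_automaticPackingThesis_iff_uniformGap` is a uniform packing ceiling `τ₀ > 2/3` for STPP
designs in every `ℤ/N`, `N ≥ 2`; apply it at `N = p^k`, `k ≥ 1`, to the level-`k` block family
reindexed along `Fin n ≃ (Fin k → ι)`. -/
theorem allTowerGap_of_not_automaticPackingThesis (h : ¬ AutomaticPackingThesis) : AllTowerGap := by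
  classical
  intro p ι _ LA LB LC hp _ _ _ blk hS
  obtain ⟨τ₀, hτ₀, hall⟩ :=
    Summit.MatrixMultiplication.MatrixMultiplication.Theorems.AutomaticPackingThesis.not_automaticPackingThesis_iff_uniformGap.1 h
  refine ⟨3 * τ₀ - 2, by linarith, 1, fun k hk => ?_⟩
  have hexp : (2 + (3 * τ₀ - 2)) / 3 = τ₀ := by ring
  rw [hexp]
  have hN : 2 ≤ p ^ k :=
    le_trans (by simpa using hp) (Nat.pow_le_pow_right (by omega) hk)
  set e : Fin (Fintype.card (Fin k → ι)) ≃ (Fin k → ι) := (Fintype.equivFin (Fin k → ι)).symm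
    with he
  have hS' : IsSTPP (blk k LA ∘ e) (blk k LB ∘ e) (blk k LC ∘ e) :=
    (isSTPP_iff_addSimultaneousTPP _ _ _).2 ((hS k).comp e.injective)
  have hle := hall (p ^ k) (Fintype.card (Fin k → ι)) hN _ _ _ hS'
  rw [Nat.cast_pow] at hle
  refine le_trans (le_of_eq ?_) hle
  exact (e.sum_comp (fun w => (((blk k LA w).card * (blk k LB w).card * (blk k LC w).card : ℕ) :
    ℝ) ^ τ₀)).symm

/-- **Off-path certificate 1′.** `¬ AutomaticPackingThesis → TowerGap 𝒞` for every class `𝒞`; in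
particular the next rung `ContextFreeTowerGap` is implied by the NEGATION of the open crux. -/
theorem towerGap_of_not_automaticPackingThesis (𝒞 : ∀ α : Type, Language α → Prop)
    (h : ¬ AutomaticPackingThesis) : TowerGap 𝒞 :=
  towerGap_of_allTowerGap 𝒞 (allTowerGap_of_not_automaticPackingThesis h)

/-- **Off-path certificate 2.** If the SUMMIT fails (`ω(ℂ) ≠ 2`, i.e. `ω > 2` by the flattening
bound), every rung holds outright, with `ε = ω - 2`: CKSU 2005 Thm 5.5 (abelian case, proved in the
tree) bounds `∑_w (|A_w||B_w||C_w|)^{ω/3} ≤ |ℤ/(p^k)| = p^k` for every STPP family at every scale.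
So the whole ladder consists of consequences of `¬ S`; none of its rungs is a step toward `S`. -/
theorem allTowerGap_of_not_summit (hS : ¬ _root_.MatrixMultiplication) : AllTowerGap := by
  classical
  intro p ι _ LA LB LC hp _ _ _ blk hSTPP
  rw [MatrixMultiplication_iff] at hS
  have hlt : 2 < omega ℂ := lt_of_le_of_ne (omega_two_le ℂ) (Ne.symm hS)
  refine ⟨omega ℂ - 2, sub_pos.2 hlt, 0, fun k _ => ?_⟩
  have hexp : (2 + (omega ℂ - 2)) / 3 = omega ℂ / 3 := by ring
  rw [hexp]
  haveI : NeZero (p ^ k) := ⟨pow_ne_zero _ (by omega)⟩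
  set e : Fin (Fintype.card (Fin k → ι)) ≃ (Fin k → ι) := (Fintype.equivFin (Fin k → ι)).symm
    with he
  have hS' : IsSTPP (blk k LA ∘ e) (blk k LB ∘ e) (blk k LC ∘ e) :=
    (isSTPP_iff_addSimultaneousTPP _ _ _).2 ((hSTPP k).comp e.injective)
  have hle := CohnKleinbergSzegedyUmans2005_5_5_abelian_holds (ZMod (p ^ k)) (Fintype.card (Fin k → ι))
    _ _ _ hS'
  rw [ZMod.card, Nat.cast_pow] at hle
  refine le_trans (le_of_eq ?_) hle
  exact (e.sum_comp (fun w => (((blk k LA w).card * (blk k LB w).card * (blk k LC w).card : ℕ) :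
    ℝ) ^ (omega ℂ / 3))).symm

/-- `¬ S → TowerGap 𝒞` for every class; with `𝒞 = IsContextFree` this is the forward tribunal's
"off-path" finding for the next rung (`S → Rung` does not close, `¬ S → Rung` does). -/
theorem towerGap_of_not_summit (𝒞 : ∀ α : Type, Language α → Prop)
    (hS : ¬ _root_.MatrixMultiplication) : TowerGap 𝒞 :=
  towerGap_of_allTowerGap 𝒞 (allTowerGap_of_not_summit hS)

/-- Contrapositive reading: REFUTING any rung (e.g. exhibiting one context-free tower beating every
exponent gap) would prove the parent crux and hence `ω = 2`. -/
theorem summit_of_not_towerGap (𝒞 : ∀ α : Type, Language α → Prop) (h : ¬ TowerGap 𝒞) :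
    _root_.MatrixMultiplication := by
  by_contra hS
  exact h (towerGap_of_not_summit 𝒞 hS)


/-! ## The top of the ladder is exactly the negation of the open crux

`AllTowerGap → ¬ AutomaticPackingThesis`: if some base `p` carries, for every `ε > 0`, a regular
tower beating `p^k` at exponent `(2+ε)/3` infinitely often, then ONE unrestricted tower over the
alphabet `Fin p` beats every exponent gap: compress each beating level (an STPP design in `ℤ/(p^k)`
indexed by `ι^k`) into the digit words `Fin k → Fin p` — possible because an STPP design with all
parts nonempty has at most `|ℤ/(p^k)| = p^k` indices (packing bound) — and interleave the levels at
strictly increasing scales. -/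

/-- **Compression by the packing bound.** An STPP family in a finite abelian group `H` can be
re-indexed by any finite type `V` with `|H| ≤ |V|` without losing STPP or packing mass: drop the
indices with an empty part (mass `0`), embed the at most `|H|` live ones into `V`, pad with empty
triples. -/
theorem compress {H : Type} [AddCommGroup H] [Fintype H] [DecidableEq H] {W V : Type}
    [Fintype W] [Fintype V] (A B C : W → Finset H) (hS : AddSimultaneousTPP A B C)
    (hcard : Fintype.card H ≤ Fintype.card V) {τ : ℝ} (hτ : 0 < τ) :
    ∃ (A' B' C' : V → Finset H), AddSimultaneousTPP A' B' C' ∧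
      ∑ w, (((A w).card * (B w).card * (C w).card : ℕ) : ℝ) ^ τ ≤
        ∑ v, (((A' v).card * (B' v).card * (C' v).card : ℕ) : ℝ) ^ τ := by
  classical
  -- the live indices
  set G : Finset W := Finset.univ.filter
    (fun w => (A w).Nonempty ∧ (B w).Nonempty ∧ (C w).Nonempty) with hG
  have hmemG : ∀ w, w ∈ G ↔ (A w).Nonempty ∧ (B w).Nonempty ∧ (C w).Nonempty := by
    intro w; simp [hG]
  -- the live sub-family is STPP with all parts nonempty, so it packs: `|G| ≤ |H| ≤ |V|`
  have hSG : AddSimultaneousTPP (A ∘ (Subtype.val : G → W)) (B ∘ Subtype.val) (C ∘ Subtype.val) :=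
    hS.comp Subtype.val_injective
  have hpack := hSG.sum_card_mul_card_le (fun g => ((hmemG g.1).1 g.2).2.2)
  have hcardG : Fintype.card G ≤ Fintype.card V := by
    refine le_trans ?_ (hpack.trans hcard)
    calc Fintype.card G = ∑ _g : G, 1 := by simp
      _ ≤ ∑ g : G, ((A ∘ Subtype.val) g).card * ((B ∘ Subtype.val) g).card :=
        Finset.sum_le_sum fun g _ => Nat.succ_le_of_lt (Nat.mul_pos
          (Finset.card_pos.2 ((hmemG g.1).1 g.2).1) (Finset.card_pos.2 ((hmemG g.1).1 g.2).2.1))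
  obtain ⟨f⟩ : Nonempty (G ↪ V) := Function.Embedding.nonempty_of_card_le hcardG
  -- pad with empty triples outside the range of `f`
  have live : ∀ (X : W → Finset H) (v : V) (x : H),
      x ∈ Function.extend f (fun g : G => X g.1) (fun _ => (∅ : Finset H)) v → ∃ g, f g = v := by
    intro X v x hx
    by_contra hv
    rw [Function.extend_apply' _ _ _ hv] at hx
    simp at hx
  have hin : ∀ (X : W → Finset H) (g : G),
      Function.extend f (fun g : G => X g.1) (fun _ => (∅ : Finset H)) (f g) = X g.1 :=
    fun X g => f.injective.extend_apply _ _ g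
  refine ⟨Function.extend f (fun g : G => A g.1) (fun _ => ∅),
    Function.extend f (fun g : G => B g.1) (fun _ => ∅),
    Function.extend f (fun g : G => C g.1) (fun _ => ∅), ?_, ?_⟩
  · rw [addSimultaneousTPP_iff_forall] at hS ⊢
    intro i j k s hs s' hs' t ht t' ht' u hu u' hu' h0
    obtain ⟨gi, rfl⟩ := live A i s' hs'
    obtain ⟨gj, rfl⟩ := live B _ t' ht'
    obtain ⟨gk, rfl⟩ := live A _ s hs
    rw [hin] at hs hs' ht ht' hu hu'
    obtain ⟨h1, h2, h3, h4, h5⟩ := hS gi.1 gj.1 gk.1 s hs s' hs' t ht t' ht' u hu u' hu' h0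
    exact ⟨by rw [Subtype.ext h1], by rw [Subtype.ext h2], h3, h4, h5⟩
  · have hzero : ∀ w, w ∉ G → (((A w).card * (B w).card * (C w).card : ℕ) : ℝ) ^ τ = 0 := by
      intro w hw
      rw [hmemG] at hw
      have h0 : (A w).card * (B w).card * (C w).card = 0 := by
        simp only [not_and_or, Finset.not_nonempty_iff_eq_empty] at hw
        rcases hw with h | h | h <;> simp [h]
      rw [h0, Nat.cast_zero, Real.zero_rpow hτ.ne']
    calc ∑ w, (((A w).card * (B w).card * (C w).card : ℕ) : ℝ) ^ τ
        = ∑ w ∈ G, (((A w).card * (B w).card * (C w).card : ℕ) : ℝ) ^ τ :=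
          (Finset.sum_subset (Finset.subset_univ G) fun w _ hw => hzero w hw).symm
      _ = ∑ g : G, (((A g.1).card * (B g.1).card * (C g.1).card : ℕ) : ℝ) ^ τ :=
          (Finset.sum_coe_sort G _).symm
      _ = ∑ g : G, (((Function.extend f (fun g : G => A g.1) (fun _ => ∅) (f g)).card *
            (Function.extend f (fun g : G => B g.1) (fun _ => ∅) (f g)).card *
            (Function.extend f (fun g : G => C g.1) (fun _ => ∅) (f g)).card : ℕ) : ℝ) ^ τ := by
          simp only [hin]
      _ = ∑ v ∈ (Finset.univ : Finset G).map f,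
            (((Function.extend f (fun g : G => A g.1) (fun _ => ∅) v).card *
            (Function.extend f (fun g : G => B g.1) (fun _ => ∅) v).card *
            (Function.extend f (fun g : G => C g.1) (fun _ => ∅) v).card : ℕ) : ℝ) ^ τ :=
          by rw [Finset.sum_map]
      _ ≤ _ := Finset.sum_le_univ_sum_of_nonneg fun v => by positivity

/-- Scale bookkeeping for the interleaving: `nextScale kf 0 = 1`,
`nextScale kf (j+1) = kf j (nextScale kf j) + 1`. -/
def nextScale (kf : ℕ → ℕ → ℕ) : ℕ → ℕ
  | 0 => 1
  | j + 1 => kf j (nextScale kf j) + 1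

/-- The scale at which tower `j` is placed: `kf j (nextScale kf j)` (strictly increasing in `j` as
soon as `k₀ ≤ kf j k₀`). -/
abbrev scaleAt (kf : ℕ → ℕ → ℕ) (j : ℕ) : ℕ := kf j (nextScale kf j)

/-- **The interleaved language**: the words `(v, a)` of length `scaleAt kf j` (index track `v`,
digit track `a`, both over `Fin p`) whose digit value lies in the block `𝒜 j v`. -/
def interleave (p : ℕ) (kf : ℕ → ℕ → ℕ)
    (𝒜 : ∀ j, (Fin (scaleAt kf j) → Fin p) → Finset (ZMod (p ^ scaleAt kf j))) :
    Language (Fin p × Fin p) :=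
  {l | ∃ (j : ℕ) (v a : Fin (scaleAt kf j) → Fin p),
    l = List.ofFn (fun i => (v i, a i)) ∧ (digitValue a : ZMod (p ^ scaleAt kf j)) ∈ 𝒜 j v}

theorem mem_interleave {p : ℕ} {kf : ℕ → ℕ → ℕ}
    {𝒜 : ∀ j, (Fin (scaleAt kf j) → Fin p) → Finset (ZMod (p ^ scaleAt kf j))}
    {l : List (Fin p × Fin p)} :
    l ∈ interleave p kf 𝒜 ↔ ∃ (j : ℕ) (v a : Fin (scaleAt kf j) → Fin p),
      l = List.ofFn (fun i => (v i, a i)) ∧ (digitValue a : ZMod (p ^ scaleAt kf j)) ∈ 𝒜 j v :=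
  Iff.rfl

/-- At the scale of tower `j` the interleaved language reads exactly the design `𝒜 j`. -/
theorem automaticBlock_interleave {p : ℕ} [NeZero p] {kf : ℕ → ℕ → ℕ}
    (hinj : Function.Injective (scaleAt kf))
    (𝒜 : ∀ j, (Fin (scaleAt kf j) → Fin p) → Finset (ZMod (p ^ scaleAt kf j))) (j : ℕ)
    (v : Fin (scaleAt kf j) → Fin p) :
    automaticBlock p (scaleAt kf j) (interleave p kf 𝒜) v = 𝒜 j v := by
  ext x
  rw [mem_automaticBlock]
  constructor
  · rintro ⟨a, ha, rfl⟩
    obtain ⟨j', v', a', heq, hmem⟩ := mem_interleave.1 ha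
    have hlen : scaleAt kf j = scaleAt kf j' := by
      simpa using congrArg List.length heq
    obtain rfl : j = j' := hinj hlen
    have hva : (fun i => (v i, a i)) = fun i => (v' i, a' i) := List.ofFn_injective heq
    have hv : v = v' := funext fun i => congrArg Prod.fst (congrFun hva i)
    have ha' : a = a' := funext fun i => congrArg Prod.snd (congrFun hva i)
    subst hv ha'
    exact hmem
  · intro hx
    refine ⟨digits p _ x, ?_, natCast_digitValue_digits x⟩
    exact mem_interleave.2 ⟨j, v, digits p _ x, rfl, by rwa [natCast_digitValue_digits]⟩

/-- At every other scale the interleaved language reads nothing. -/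
theorem automaticBlock_interleave_eq_empty {p : ℕ} {kf : ℕ → ℕ → ℕ}
    (𝒜 : ∀ j, (Fin (scaleAt kf j) → Fin p) → Finset (ZMod (p ^ scaleAt kf j))) (k : ℕ)
    (hk : ∀ j, scaleAt kf j ≠ k) (v : Fin k → Fin p) :
    automaticBlock p k (interleave p kf 𝒜) v = ∅ := by
  ext x
  simp only [Finset.notMem_empty, iff_false]
  intro hx
  obtain ⟨a, ha, -⟩ := (mem_automaticBlock _ _).1 hx
  obtain ⟨j', v', a', heq, -⟩ := mem_interleave.1 ha
  have hlen := congrArg List.length heq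
  simp only [List.length_ofFn] at hlen
  exact hk j' hlen.symm

/-- The interleaved tower is STPP at every scale. -/
theorem interleave_stpp {p : ℕ} [NeZero p] {kf : ℕ → ℕ → ℕ}
    (hinj : Function.Injective (scaleAt kf))
    (𝒜 ℬ 𝒞 : ∀ j, (Fin (scaleAt kf j) → Fin p) → Finset (ZMod (p ^ scaleAt kf j)))
    (hS : ∀ j, AddSimultaneousTPP (𝒜 j) (ℬ j) (𝒞 j)) (k : ℕ) :
    AddSimultaneousTPP (automaticBlock p k (interleave p kf 𝒜))
      (automaticBlock p k (interleave p kf ℬ)) (automaticBlock p k (interleave p kf 𝒞)) := by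
  by_cases hk : ∃ j, scaleAt kf j = k
  · obtain ⟨j, rfl⟩ := hk
    have hA : automaticBlock p (scaleAt kf j) (interleave p kf 𝒜) = 𝒜 j :=
      funext (automaticBlock_interleave hinj 𝒜 j)
    have hB : automaticBlock p (scaleAt kf j) (interleave p kf ℬ) = ℬ j :=
      funext (automaticBlock_interleave hinj ℬ j)
    have hC : automaticBlock p (scaleAt kf j) (interleave p kf 𝒞) = 𝒞 j :=
      funext (automaticBlock_interleave hinj 𝒞 j)
    rw [hA, hB, hC]
    exact hS j
  · push Not at hk
    rw [addSimultaneousTPP_iff_forall]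
    intro i j k' s hs
    rw [automaticBlock_interleave_eq_empty 𝒜 k hk] at hs
    simp at hs

/-- **The top of the ladder refutes the open crux.** -/
theorem not_automaticPackingThesis_of_allTowerGap (hgap : AllTowerGap) :
    ¬ AutomaticPackingThesis := by
  classical
  rintro ⟨p, hp, h⟩
  haveI : NeZero p := ⟨by omega⟩
  -- Step 1 (compression): for every `j` and `k₀`, an STPP design at some scale `k ≥ k₀` indexed by
  -- the digit words `Fin k → Fin p`, beating `p^k` at `ε_j = 1/(j+1)`.
  have D : ∀ j k₀ : ℕ, ∃ k, k₀ ≤ k ∧ ∃ (A B C : (Fin k → Fin p) → Finset (ZMod (p ^ k))),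
      AddSimultaneousTPP A B C ∧ (p : ℝ) ^ k <
        ∑ v, (((A v).card * (B v).card * (C v).card : ℕ) : ℝ) ^ ((2 + 1 / ((j : ℝ) + 1)) / 3) := by
    intro j k₀
    have hεj : (0 : ℝ) < 1 / ((j : ℝ) + 1) := by positivity
    obtain ⟨ι, _, LA, LB, LC, -, -, -, hS, hbeat⟩ := h _ hεj
    obtain ⟨k, hk, hbk⟩ := hbeat k₀
    haveI : NeZero (p ^ k) := ⟨pow_ne_zero _ (by omega)⟩
    have hSk : AddSimultaneousTPP (automaticBlock p k LA) (automaticBlock p k LB)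
        (automaticBlock p k LC) := hS k
    have hcard : Fintype.card (ZMod (p ^ k)) ≤ Fintype.card (Fin k → Fin p) := by
      rw [ZMod.card, Fintype.card_fun, Fintype.card_fin, Fintype.card_fin]
    obtain ⟨A', B', C', hS', hsum⟩ :=
      compress _ _ _ hSk hcard (τ := (2 + 1 / ((j : ℝ) + 1)) / 3) (by positivity)
    exact ⟨k, hk, A', B', C', hS', hbk.trans_le hsum⟩
  choose kf hkf A B C hS hbeat using D
  -- Step 2: strictly increasing scales `scaleAt kf j`, tower `j` read at `k₀ = nextScale kf j`.
  have hmono : StrictMono (scaleAt kf) :=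
    strictMono_nat_of_lt_succ fun j => hkf (j + 1) (nextScale kf (j + 1))
  -- Step 3: the interleaved tower over the alphabet `Fin p`, STPP at every scale.
  have hST := interleave_stpp hmono.injective (fun j => A j (nextScale kf j))
    (fun j => B j (nextScale kf j)) (fun j => C j (nextScale kf j)) (fun j => hS j (nextScale kf j))
  obtain ⟨ε, hε, k₀, hk⟩ := hgap p (Fin p) (interleave p kf fun j => A j (nextScale kf j))
    (interleave p kf fun j => B j (nextScale kf j)) (interleave p kf fun j => C j (nextScale kf j))
    hp trivial trivial trivial hST
  -- Step 4: a late tower `j` with `ε_j ≤ ε` placed beyond `k₀` contradicts the gap.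
  obtain ⟨j, hjk, hjε⟩ : ∃ j : ℕ, k₀ ≤ j ∧ 1 / ((j : ℝ) + 1) ≤ ε := by
    refine ⟨max k₀ ⌈1 / ε⌉₊, le_max_left _ _, le_of_lt ?_⟩
    rw [one_div_lt (by positivity) hε]
    calc 1 / ε ≤ ⌈1 / ε⌉₊ := Nat.le_ceil _
      _ ≤ ((max k₀ ⌈1 / ε⌉₊ : ℕ) : ℝ) := by exact_mod_cast le_max_right _ _
      _ < _ := lt_add_one _
  have hK : k₀ ≤ scaleAt kf j := hjk.trans (hmono.id_le j)
  have hgapK := hk (scaleAt kf j) hK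
  have hA := automaticBlock_interleave hmono.injective (fun j => A j (nextScale kf j)) j
  have hB := automaticBlock_interleave hmono.injective (fun j => B j (nextScale kf j)) j
  have hC := automaticBlock_interleave hmono.injective (fun j => C j (nextScale kf j)) j
  have hle : ∑ v : Fin (scaleAt kf j) → Fin p, (((A j (nextScale kf j) v).card *
      (B j (nextScale kf j) v).card * (C j (nextScale kf j) v).card : ℕ) : ℝ) ^ ((2 + ε) / 3) ≤
      (p : ℝ) ^ scaleAt kf j := by
    have e : ∀ v : Fin (scaleAt kf j) → Fin p,
        (((A j (nextScale kf j) v).card * (B j (nextScale kf j) v).card *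
          (C j (nextScale kf j) v).card : ℕ) : ℝ) ^ ((2 + ε) / 3) =
        (((automaticBlock p (scaleAt kf j) (interleave p kf fun j => A j (nextScale kf j)) v).card *
          (automaticBlock p (scaleAt kf j) (interleave p kf fun j => B j (nextScale kf j)) v).card *
          (automaticBlock p (scaleAt kf j) (interleave p kf fun j => C j (nextScale kf j)) v).card :
            ℕ) : ℝ) ^ ((2 + ε) / 3) := by
      intro v; rw [hA, hB, hC]
    rw [Finset.sum_congr rfl fun v _ => e v]
    exact hgapK
  have hbeatK := hbeat j (nextScale kf j)
  -- monotonicity of `x ↦ x^τ` in `τ` on naturals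
  have hmonoτ : ∑ v : Fin (scaleAt kf j) → Fin p, (((A j (nextScale kf j) v).card *
      (B j (nextScale kf j) v).card * (C j (nextScale kf j) v).card : ℕ) : ℝ) ^
        ((2 + 1 / ((j : ℝ) + 1)) / 3) ≤
      ∑ v : Fin (scaleAt kf j) → Fin p, (((A j (nextScale kf j) v).card *
      (B j (nextScale kf j) v).card * (C j (nextScale kf j) v).card : ℕ) : ℝ) ^ ((2 + ε) / 3) := by
    refine Finset.sum_le_sum fun v _ => ?_
    rcases Nat.eq_zero_or_pos ((A j (nextScale kf j) v).card * (B j (nextScale kf j) v).card *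
      (C j (nextScale kf j) v).card) with hz | hpos
    · rw [hz, Nat.cast_zero, Real.zero_rpow (by positivity), Real.zero_rpow (by positivity)]
    · exact Real.rpow_le_rpow_of_exponent_le (by exact_mod_cast hpos) (by linarith)
  exact absurd ((hbeatK.trans_le hmonoτ).trans_le hle) (lt_irrefl _)

/-- **Ladder top ⟺ ¬ crux.** The unrestricted tower gap is exactly the negation of the parent
route's open crux `AutomaticPackingThesis` (so the Chomsky ladder regular ⊂ context-free ⊂ … ⊂ all
climbs from the proved floor to the route's KILL criterion, never toward `ω = 2`). -/
theorem allTowerGap_iff_not_automaticPackingThesis : AllTowerGap ↔ ¬ AutomaticPackingThesis :=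
  ⟨not_automaticPackingThesis_of_allTowerGap, allTowerGap_of_not_automaticPackingThesis⟩

end Summit.MatrixMultiplication.MatrixMultiplication.Cruxes.AutomaticPackingThesis.FwdRung

end
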